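import Summits.CriticalPhenomena.CardyFormulaZ2.Theorems.CardyMagicRigidityLoopsToCrossingsStubDiscreteCrossingOfPathIn
import Summits.CriticalPhenomena.CardyFormulaZ2.Theorems.ModulusResponseSmirnovCellAnchorCellPaths
import Summits.CriticalPhenomena.CardyFormulaZ2.Theorems.ModulusResponseSmirnovCellAnchorFrame

/-!
# Lower half of the cell/site sandwich: an open `𝕋`-path gives a G02 cell crossing of `ℤ²`
(support item `SmirnovCellAnchor`)

Helper file for `Summit.CriticalPhenomena.CardyFormulaZ2.Theses.ModulusResponse.SmirnovCellAnchor`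
(stmt-CriticalPhenomena-6471). The cell configuration `Φ X` on `ℤ²` (left and down edges of the
sites of `X`) is studied in the `ℤ²` frame of a conformal rectangle `Q`, while the open sites `X`
are a site configuration of `𝕋` read in the equilateral frame of the rectangle `W = g(Q)`,
`g(x + iy) = x + y ζ`. **Lower half** (Bollobás–Riordan 2006, Ch. 7, Claim 19 p. 192 and remark
p. 195, cell/site port): for `ρ > 0` and all small `δ`, `t`, an open `𝕋`-path of sites of `X`
from an off-`W` site near `W.arc 0` to an off-`W` site near `W.arc 2`, whose off-`W` sites are
`t`-close to `W.arc 0 ∪ W.arc 2`, whose in-`W` sites are `8δ`-off `W.arc 1 ∪ W.arc 3`, and all of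
whose sites are `ρ`-off the marked points, forces the G02 crossing event
`Φ X ∈ discreteCrossing Q δ (Q.arc 0) (Q.arc 2)` of the `ℤ²` recipe (largest mesh component,
discrete arcs). Proof: the path is an open bond path of `Φ X` through its sites and the corner
vertices of its diagonal steps (`pathIn_openGraph_of_pathIn_triGraph`); the frame change costs a
factor `2` in all distances (`Frame`); the corner vertices inherit the hypotheses up to one mesh
step (corner separation `far_arc_of_far_corners` for corners next to an outside site); then the
`ℤ²` lower half `stub_discreteCrossing_of_pathIn` of the tree applies.
-/

noncomputable section

namespace Summit.CriticalPhenomena.CardyFormulaZ2.Theorems.SmirnovCellAnchor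

open Set Metric
open Literature.Probability.Percolation Literature.Probability.LatticeModels
  Literature.Probability.RandomPlanarGeometry
open Summit.CriticalPhenomena.CardyFormulaZ2.Cruxes.LoopsToCrossings.OracleSandwich

/-- A corner vertex `w` (with `w + e₀ ∈ S`) is one mesh step from a site of `S`. [folklore] -/
theorem dist_meshPoint_add_single {δ : ℝ} (hδ : 0 < δ) (w : Site 2) (i : Fin 2) :
    dist (meshPoint δ w) (meshPoint δ (w + Pi.single i 1)) = δ := by
  rw [dist_meshPoint_of_adj ((zdGraph_adj_iff _ _).2 ⟨i, Or.inl rfl⟩), abs_of_pos hδ]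

/-- **Lower half of the cell/site sandwich, deterministic form** (see the module docstring).
[cite: BollobasRiordan2006, Ch. 7 Claim 19 p. 192 and remark p. 195] -/
theorem cell_mem_discreteCrossing_of_pathIn
    (Φ : Set (Site 2) → BondConfig (Site 2))
    (hΦ : ∀ X, Φ X = {e | ∃ m ∈ X, e = s(m - Pi.single 0 1, m) ∨ e = s(m - Pi.single 1 1, m)})
    (g : ℂ → ℂ) (hg : ∀ z, g z = (z.re : ℂ) + (z.im : ℂ) * triZeta)
    (Q W : ConformalRectangle) (hW : W.carrier = g '' Q.carrier)
    (hWarc : ∀ i, W.arc i = g '' Q.arc i) (hWpt : ∀ j, W.pt j = g (Q.pt j)) {ρ : ℝ} (hρ : 0 < ρ) :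
    ∃ δ₀ > 0, ∃ t₀ > 0, ∀ δ t : ℝ, 0 < δ → δ < δ₀ → 0 ≤ t → t ≤ t₀ →
      ∀ (X S : Set (Site 2)) (u v : Site 2), S ⊆ X →
        (∀ x ∈ S, triMeshPoint δ x ∉ W.carrier →
          infDist (triMeshPoint δ x) (W.arc 0) ≤ t ∨ infDist (triMeshPoint δ x) (W.arc 2) ≤ t) →
        (∀ x ∈ S, triMeshPoint δ x ∈ W.carrier →
          8 * δ < infDist (triMeshPoint δ x) (W.arc 1) ∧ 8 * δ < infDist (triMeshPoint δ x) (W.arc 3)) →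
        (∀ x ∈ S, ∀ j : Fin 4, ρ ≤ dist (triMeshPoint δ x) (W.pt j)) →
        triMeshPoint δ u ∉ W.carrier → infDist (triMeshPoint δ u) (W.arc 0) ≤ t →
        triMeshPoint δ v ∉ W.carrier → infDist (triMeshPoint δ v) (W.arc 2) ≤ t →
        PathIn triGraph S u v →
        Φ X ∈ discreteCrossing Q.carrier δ (Q.arc 0) (Q.arc 2) := by
  obtain ⟨δA, hδA, tA, htA, hA⟩ := stub_discreteCrossing_of_pathIn Q
  obtain ⟨κ, hκ, hfar_arc⟩ := far_arc_of_far_corners Q (ρ₀ := ρ / 4) (by positivity)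
  refine ⟨min δA (min (tA / 8) (min (κ / 8) (ρ / 8))), by positivity, min (tA / 8) (κ / 8), by positivity, ?_⟩
  intro δ t hδ hδlt ht htle X S u v hSX hout hin hcorner huW huA hvW hvB hP
  have hδA' : δ < δA := hδlt.trans_le (min_le_left _ _)
  have hδtA : δ < tA / 8 := hδlt.trans_le ((min_le_right _ _).trans (min_le_left _ _))
  have hδκ : δ < κ / 8 := hδlt.trans_le ((min_le_right _ _).trans ((min_le_right _ _).trans (min_le_left _ _)))
  have hδρ : δ < ρ / 8 := hδlt.trans_le ((min_le_right _ _).trans ((min_le_right _ _).trans (min_le_right _ _)))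
  have httA : t ≤ tA / 8 := htle.trans (min_le_left _ _)
  have htκ : t ≤ κ / 8 := htle.trans (min_le_right _ _)
  -- frame transfer
  have hgm : ∀ x : Site 2, g (meshPoint δ x) = triMeshPoint δ x := g_meshPoint g hg δ
  have hmemW : ∀ x : Site 2, triMeshPoint δ x ∈ W.carrier ↔ meshPoint δ x ∈ Q.carrier := fun x => by
    rw [← hgm, hW, g_mem_image_iff g hg]
  have hdn : ∀ (x : Site 2) (i : Fin 4), infDist (meshPoint δ x) (Q.arc i) ≤ 2 * infDist (triMeshPoint δ x) (W.arc i) :=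
    fun x i => by rw [hWarc, ← hgm]; exact infDist_le_two_mul_infDist_g g hg _ _
  have hup : ∀ (x : Site 2) (i : Fin 4), infDist (triMeshPoint δ x) (W.arc i) ≤ 2 * infDist (meshPoint δ x) (Q.arc i) :=
    fun x i => by rw [hWarc, ← hgm]; exact infDist_g_le_two_mul_infDist g hg _ _
  have hcor : ∀ x ∈ S, ∀ j : Fin 4, ρ / 2 ≤ dist (meshPoint δ x) (Q.pt j) := fun x hx j => by
    refine half_le_dist_of_le_dist_g g hg ?_
    rw [hgm, ← hWpt]; exact hcorner x hx j
  -- the sites of `S` in the `ℤ²` frame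
  have hSout : ∀ x ∈ S, meshPoint δ x ∉ Q.carrier →
      infDist (meshPoint δ x) (Q.arc 0) ≤ 2 * t ∨ infDist (meshPoint δ x) (Q.arc 2) ≤ 2 * t := by
    intro x hx hxQ
    rcases hout x hx (fun h => hxQ ((hmemW x).1 h)) with h | h
    · exact Or.inl ((hdn x 0).trans (by linarith))
    · exact Or.inr ((hdn x 2).trans (by linarith))
  have hSin : ∀ x ∈ S, meshPoint δ x ∈ Q.carrier →
      4 * δ < infDist (meshPoint δ x) (Q.arc 1) ∧ 4 * δ < infDist (meshPoint δ x) (Q.arc 3) := by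
    intro x hx hxQ
    obtain ⟨h1, h3⟩ := hin x hx ((hmemW x).2 hxQ)
    exact ⟨by linarith [hup x 1], by linarith [hup x 3]⟩
  -- frontier decomposition
  have hfr : frontier Q.carrier ⊆ (Q.arc 0 ∪ Q.arc 2) ∪ (Q.arc 1 ∪ Q.arc 3) := frontier_subset_arcs_zero_two Q
  -- corner vertices: `w + e₀ ∈ S`
  set T : Set (Site 2) := S ∪ {w | w + Pi.single 0 1 ∈ S ∧ w + Pi.single 1 1 ∈ S} with hT
  have hpath : PathIn (openGraph (Φ X) ⊓ zdGraph 2) T u v := pathIn_openGraph_of_pathIn_triGraph Φ hΦ hSX hP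
  -- key estimates for a corner vertex `w` next to the site `m = w + e₀ ∈ S`
  have hwout : ∀ w : Site 2, w + Pi.single 0 1 ∈ S → meshPoint δ w ∉ Q.carrier →
      infDist (meshPoint δ w) (Q.arc 0) ≤ 2 * t + 2 * δ ∨ infDist (meshPoint δ w) (Q.arc 2) ≤ 2 * t + 2 * δ := by
    intro w hm hwQ
    have hdw : dist (meshPoint δ w) (meshPoint δ (w + Pi.single 0 1)) = δ := dist_meshPoint_add_single hδ w 0
    by_cases hmQ : meshPoint δ (w + Pi.single 0 1) ∈ Q.carrier
    · -- the mesh edge `[m, w]` leaves `Q`: its frontier point lies on `arc 0 ∪ arc 2`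
      have hseg : ¬ segment ℝ (meshPoint δ (w + Pi.single 0 1)) (meshPoint δ w) ⊆ Q.carrier :=
        fun h => hwQ (h (right_mem_segment ℝ _ _))
      obtain ⟨f, hf, hffr⟩ := exists_mem_segment_frontier Q.isOpen hmQ hseg
      have hfm : dist f (meshPoint δ (w + Pi.single 0 1)) ≤ δ := by
        have hadj : (zdGraph 2).Adj (w + Pi.single 0 1) w := ((zdGraph_adj_iff _ _).2 ⟨0, Or.inl rfl⟩).symm
        exact mem_closedBall.1 (segment_meshPoint_subset_closedBall_z2 hδ hadj hf)
      have hfw : dist (meshPoint δ w) f ≤ 2 * δ := by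
        have := dist_triangle (meshPoint δ w) (meshPoint δ (w + Pi.single 0 1)) f
        rw [dist_comm f] at hfm; linarith
      obtain ⟨h1, h3⟩ := hSin _ hm hmQ
      have hf13 : f ∉ Q.arc 1 ∪ Q.arc 3 := by
        rintro (hf1 | hf3)
        · have := infDist_le_dist_of_mem (x := meshPoint δ (w + Pi.single 0 1)) hf1
          rw [dist_comm] at hfm; linarith
        · have := infDist_le_dist_of_mem (x := meshPoint δ (w + Pi.single 0 1)) hf3
          rw [dist_comm] at hfm; linarith
      rcases hfr hffr with (hf0 | hf2) | hf13'
      · exact Or.inl ((infDist_le_dist_of_mem hf0).trans (by linarith))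
      · exact Or.inr ((infDist_le_dist_of_mem hf2).trans (by linarith))
      · exact absurd hf13' hf13
    · rcases hSout _ hm hmQ with h | h
      · left
        have := infDist_le_infDist_add_dist (s := Q.arc 0) (x := meshPoint δ w) (y := meshPoint δ (w + Pi.single 0 1))
        linarith
      · right
        have := infDist_le_infDist_add_dist (s := Q.arc 2) (x := meshPoint δ w) (y := meshPoint δ (w + Pi.single 0 1))
        linarith
  have hwin : ∀ w : Site 2, w + Pi.single 0 1 ∈ S → meshPoint δ w ∈ Q.carrier →
      δ < infDist (meshPoint δ w) (Q.arc 1) ∧ δ < infDist (meshPoint δ w) (Q.arc 3) := by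
    intro w hm hwQ
    have hdw : dist (meshPoint δ w) (meshPoint δ (w + Pi.single 0 1)) = δ := dist_meshPoint_add_single hδ w 0
    by_cases hmQ : meshPoint δ (w + Pi.single 0 1) ∈ Q.carrier
    · obtain ⟨h1, h3⟩ := hSin _ hm hmQ
      have e1 := infDist_le_infDist_add_dist (s := Q.arc 1) (x := meshPoint δ (w + Pi.single 0 1)) (y := meshPoint δ w)
      have e3 := infDist_le_infDist_add_dist (s := Q.arc 3) (x := meshPoint δ (w + Pi.single 0 1)) (y := meshPoint δ w)
      rw [dist_comm] at e1 e3
      exact ⟨by linarith, by linarith⟩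
    · -- `m` is outside near `arc 0 ∪ arc 2`, and `w` is far from the corners: corner separation
      have hwfar : ∀ j : Fin 4, ρ / 4 ≤ dist (meshPoint δ w) (Q.pt j) := fun j => by
        have := hcor _ hm j
        have := dist_triangle (meshPoint δ (w + Pi.single 0 1)) (meshPoint δ w) (Q.pt j)
        rw [dist_comm (meshPoint δ (w + Pi.single 0 1)) (meshPoint δ w)] at this
        linarith
      have key : ∀ i : Fin 4, (i = 0 ∨ i = 2) → infDist (meshPoint δ (w + Pi.single 0 1)) (Q.arc i) ≤ 2 * t →
          δ < infDist (meshPoint δ w) (Q.arc 1) ∧ δ < infDist (meshPoint δ w) (Q.arc 3) := by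
        intro i hi hmi
        have hwi : infDist (meshPoint δ w) (Q.arc i) < κ := by
          have := infDist_le_infDist_add_dist (s := Q.arc i) (x := meshPoint δ w) (y := meshPoint δ (w + Pi.single 0 1))
          linarith
        have h1 := hfar_arc (meshPoint δ w) hwfar i 1 (by rcases hi with rfl | rfl <;> decide) hwi
        have h3 := hfar_arc (meshPoint δ w) hwfar i 3 (by rcases hi with rfl | rfl <;> decide) hwi
        exact ⟨by linarith, by linarith⟩
      rcases hSout _ hm hmQ with h | h
      · exact key 0 (Or.inl rfl) h
      · exact key 2 (Or.inr rfl) h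
  -- apply the `ℤ²` lower half
  refine hA δ (2 * t + 2 * δ) hδ hδA' (by positivity) (by linarith) (Φ X) T u v ?_ ?_
    (fun h => huW ((hmemW u).2 h)) ((hdn u 0).trans (by linarith [huA]))
    (fun h => hvW ((hmemW v).2 h)) ((hdn v 2).trans (by linarith [hvB])) hpath
  · rintro x (hx | ⟨hx0, -⟩) hxQ
    · rcases hSout x hx hxQ with h | h
      · exact Or.inl (h.trans (by linarith))
      · exact Or.inr (h.trans (by linarith))
    · exact hwout x hx0 hxQ
  · rintro x (hx | ⟨hx0, -⟩) hxQ
    · obtain ⟨h1, h3⟩ := hSin x hx hxQ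
      exact ⟨by linarith, by linarith⟩
    · exact hwin x hx0 hxQ

end Summit.CriticalPhenomena.CardyFormulaZ2.Theorems.SmirnovCellAnchor

end
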